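import Summits.HodgeConjecture.HodgeConjecture.Theses.HeckePrymWeil
import Literature.AlgebraicGeometry.Motives.AbelianVarietyProjectiveChart
import Literature.AlgebraicGeometry.HodgeTheory.ComplexConjugation
import Summits.HodgeConjecture.HodgeConjecture.Theorems.SummitOffWeilSector.Negative.ConjectureGrade
import Summits.HodgeConjecture.HodgeConjecture.Theorems.WeilTwelvefoldsSqrtMinus7.Negative.LadderTyping
import Summits.HodgeConjecture.HodgeConjecture.Theorems.WeilTwelvefoldsSqrtMinus7.Negative.EigenvalueTyping
import Summits.HodgeConjecture.HodgeConjecture.Theorems.WeilTwelvefoldsSqrtMinus7.Negative.WeilPlaneReality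
import Summits.HodgeConjecture.HodgeConjecture.Theorems.WeilTwelvefoldsSqrtMinus7.Negative.KillPropagation
import Summits.HodgeConjecture.HodgeConjecture.Theorems.WeilSixfoldsSqrtMinus7.Negative.EigenvalueSeparation
import Summits.HodgeConjecture.HodgeConjecture.Theorems.WeilTenfoldsSqrtMinus11.Negative.KillPropagation

/-!
# Disproof attempts on crux `HodgeWeilLadder` (item stmt-HodgeConjecture-1259, TARGET of route HeckePrymWeil) — findings

Standing-adversary work file (cdisprove seat `refuter-cdisprove-stmt-HodgeConjecture-1259-0`, cycle 1,
2026-08-16).  Everything below is `lean check`ed (rc 0, NO `sorry`).  It EXTENDS — and imports rather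
than redoes — the negative knowledge already landed by the sibling disprovers of the three rung cruxes
and of the off-sector crux of the same route:
`Theorems/WeilTwelvefoldsSqrtMinus7/Negative/{LadderTyping, EigenvalueTyping, WeilPlaneReality, KillPropagation}`,
`Theorems/WeilSixfoldsSqrtMinus7/Negative/EigenvalueSeparation`,
`Theorems/WeilTenfoldsSqrtMinus11/Negative/KillPropagation`,
`Theorems/SummitOffWeilSector/Negative/ConjectureGrade`,
`Theorems/HodgeAbelianVarieties/Negative/KillTransfer` (`¬ HodgeWeilLadder → ¬ HodgeAbelianVarieties`).

## Verdict: NO KILL — and none is possible in the present tree (a kill is a disproof of the Clay problem)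

READ-BACK (§1, `hodgeWeilLadder_iff`, `Iff.rfl`).  With the rung predicate
`HWA p n := ∀ (A : AbelianVariety ℂ) (φ : A ⟶ A), A.dim = 2n → φ ≫ φ = -(p • 𝟙 A) → ∀ c ∈ H^{2n}(A(ℂ);ℂ),
IsRationalClass c → IsOfHodgeType (2n) A.X (2n) n n c → c ∈ Eig((𝟙+φ)^*, (1+i√p)^{2n}) ⊔ Eig((𝟙+φ)^*,
(1-i√p)^{2n}) → c ∈ algebraicClasses A.X n` (every constant a REAL definition of the tree: `AbelianVariety`
= proper geometrically-integral group scheme over `Spec ℂ`; `dim` = topological Krull dimension;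
`complexBetti.map` = pull-back; `algebraicClasses X n = NⁿH²ⁿ` with Mathlib's scheme preorder
`x ≤ y ↔ y ⤳ x` — checked `Iff.rfl` in scratch `W.lean`, so `coheight` = codimension), the crux is
`∀ p prime, p % 4 = 3, 7 ≤ p, ∀ g ≥ 2, HWA p ((p-1)/2·(g-1))`; the three rung cruxes are `HWA 7 3`,
`HWA 7 6`, `HWA 11 5` up to `push_cast` (`weilSixfolds_iff`, `weilTwelvefolds_iff`, `weilTenfolds_iff`),
`WeilDescending` is `HWA p (n+1) → HWA p n` and `SummitOffWeilSector` is `Sector → HodgeConjecture` with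
`Sector := ∀ p …, ∀ n ≥ 1, HWA p n` (`Iff.rfl` each).  No coercion junk: `(p - 1) / 2 * (g - 1)` parses as
`((p-1)/2)·(g-1)`, exact for odd `p`; `p - 1`, `g - 1` never truncate under `7 ≤ p`, `2 ≤ g`.

1. RUNG SET (§2, Lean).  `isRung_iff`: the rungs at `p` are exactly the positive multiples of
   `m = (p-1)/2 ≥ 3`; `three_le_rung`; `seven_nonrungs`: at `p = 7` the indices `n = 1, 2, 4, 5` (surfaces,
   fourfolds, eightfolds, tenfolds) are NOT rungs — the target alone never speaks about them; they enter the
   route only through `WeilDescending`.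
2. THE TARGET IS EQUI-REFUTABLE WITH THE WHOLE ℚ(√-p) SECTOR, GIVEN THE ROUTINE SUPPORT ITEM (§3, Lean,
   unconditional implications): `not_sector_of_not_hodgeWeilLadder : ¬ Ladder → ¬ Sector` (rungs are sector
   instances, `n ≥ 3 ≥ 1`) and `not_hodgeWeilLadder_of_not_sector : WeilDescending → ¬ Sector → ¬ Ladder`
   (the descent inside the route's own `closes`), hence `not_hodgeWeilLadder_iff_not_sector (hD) :
   ¬ Ladder ↔ ¬ Sector`.  Consequences: `not_hodgeWeilLadder_of_not_hwa (hD)`: a non-algebraic Hodge–Weil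
   class on ONE abelian `2n`-fold with `φ∘φ = -p`, ANY `n ≥ 1` (rung or not, any discriminant), refutes the
   target; `not_hodgeWeilLadder_of_not_rung`: from a rung no descending is needed.  So, modulo
   `WeilDescending` (Koike's product trick, planner: "mathematically routine"), the target is NOT a proper
   weakening of Weil's 1977 family of candidate counterexamples for `K = ℚ(√-p)`, `p ≡ 3 (4)`, `p ≥ 7`: it is
   that family, in every dimension and every discriminant.
3. SUMMIT-HARDNESS (§3, Lean, unconditional): `not_hodgeConjecture_of_not_hodgeWeilLadder :
   ¬ HodgeWeilLadder → ¬ HodgeConjecture` (via `antecedent_of_hodgeConjecture` of ConjectureGrade: abelian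
   varieties are smooth projective, `AbelianVariety.isSmoothProjective_holds` PROVED in the tree).  A kill
   of this crux is a disproof of the Clay problem; with André 1996 (barrier
   `Literature.Barriers.HodgeConjecture.Andre1996_hodgeClassesOnAbelianVarieties_motivated`: Hodge classes on
   abelian varieties are motivated) it would also refute Grothendieck's standard conjecture of Lefschetz
   type.  Conversely `not_hodgeWeilLadder_of_not_hodgeConjecture_of_offSector`: with the route's other two
   hypotheses a disproof of HC anywhere kills the target (contrapositive of `closes`).
4. NO SMALL / JUNK / DEGENERATE MODEL (documentation; same finding as the sibling files): the only
   `AbelianVariety ℂ` constructible in the tree is the zero group scheme (`dim 0`); every rung needs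
   `A.dim = 2n ≥ 6`; so NO statement `∀ A, A.dim = 2n → …` — the crux or any weakening — has a Lean
   counterexample today, and `kit compute` cannot touch the STATEMENT (it has no finite shadow: a
   counterexample is a transcendence statement about periods of a specific abelian variety).  The junk-model
   attack on the one `∃` in the hypotheses (`IsOfHodgeType := ∃ HodgeModel …`, exotic complex structure
   `Eⁿ × Ēⁿ` on the real torus of `E^{2n}`) fails for every rung for the reason recorded in
   `Cruxes/WeilSixfoldsSqrtMinus7/Disproof.lean` §8 (`IsAnalytification` pins the complex structure through
   affine-local regular functions; natural de Rham comparisons differ by a scalar).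
5. LOAD-BEARING ANALYSIS, hypothesis by hypothesis (§4; Lean where the tree allows, paper otherwise):
   * `2 ≤ g` — PURE DECORATION (Lean, `rung_g_le_one_trivial`): the excluded rungs `g ≤ 1` have `n = 0` and
     hold outright (`algebraicClasses X 0 = ⊤`).  Information for provers: nothing to use there.
   * `IsRationalClass c` — NOT load-bearing for truth (paper: on Weil type `(n,n)` the plane `W_K ⊗ ℂ` is of
     type `(n,n)` and `ℂ`-spanned by `W_K ⊂ H^{2n}(A,ℚ)`, and `algebraicClasses` is a `ℂ`-subspace; off Weil
     type both versions are vacuous), but load-bearing for the TYPING: Lean `rational_mem_plusEigenspace_eq_zero`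
     / `…minus…` (every `A`, every `ψ`, every `p ≥ 4`, every degree `k ≥ 1`: a rational class in ONE typed
     eigenspace is `0`, because `conjClass` fixes rational classes and swaps the eigenspaces,
     `conj (1+i√p)^k = (1-i√p)^k ≠ (1+i√p)^k` by the landed Niven lemma `one_add_I_sqrt_pow_ne`), whence
     `onlyPlusLadder_holds`, `onlyMinusLadder_holds`: the "one eigenspace only" variants of EVERY rung are
     TRUE VACUOUSLY — the `⊔` is essential; and (`weilComponents_conj`, `weilComponent_rational_imp_zero`,
     `weilComponents_ne_zero`, every `p ≥ 4`, every degree) a counterexample class to ANY rung necessarily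
     has two non-zero, conjugate, non-rational Weil components.
   * `IsOfHodgeType (2n) A.X (2n) n n c` — LOAD-BEARING (paper): drop it and `A = E^{2n}`, `E = ℂ/O_K`,
     `φ = diag(√-p)` is a counterexample (`W_K ⊗ ℂ = H^{2n,0} ⊕ H^{0,2n}`, rational, not Hodge, hence not
     algebraic — algebraic classes are `(n,n)`, Voisin I Prop. 11.20); not constructible in the tree (item 4).
   * `7 ≤ p` — load-bearing for the TYPING, not for truth: at `p = 3` the device collapses — Lean
     `typing_collapses_at_three : (1+i√3)^6 = (1-i√3)^6 (= 64)`, `middle_type_collides_at_three :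
     (1+i√3)^3 (1-i√3)^3 = 64` — so on the would-be rung `(3, 4)` (sixfolds, `φ² = -3`) the "Weil plane"
     `Eig ⊔ Eig = Eig(64)` swallows the middle Künneth type `∧³H¹_σ ⊗ ∧³H¹_σ̄` (all divisor powers `D³`):
     a different, much larger instance of HC, not Weil's classes.  (`p = 3`, `K = ℚ(√-3)`, is moreover the
     field of Schoen's cyclic-triple-cover anchors — vanGeemen1994HodgeAV §7 — the one place where a geometric
     method for Weil classes beyond the split component exists; it is outside this line by the typing.)
     The typing is faithful for every `p ≥ 4` (landed `mixed_eq_plus_iff_of_four_le`), so `7 ≤ p` could be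
     `p ∉ {2, 3}` as far as meaning goes; `p = 5` is excluded by `p % 4 = 3`, not by typing.
   * `p % 4 = 3` — NOT load-bearing for truth (for `p ≡ 1 (4)` the statement is the equally open ℚ(√-p)
     sector, e.g. `ℚ(√-5)`, `ℚ(√-13)`), but load-bearing for the MECHANISM: Lean `quadGaussSum_sq`,
     `quadGaussSum_sq_of_three_mod_four`, `quadGaussSum_sq_of_one_mod_four` (Mathlib `gaussSum_sq`): the Hecke
     element `φ = T_squares - T_nonsquares = Σ_k (k/p)[k]` acts on the `ψ_a`-isotypic part of a
     `ℤ/p`-representation by `±g`, `g² = χ(-1)·p`, which is `-p` EXACTLY when `p ≡ 3 (4)` and `+p` (real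
     multiplication by `ℚ(√p)`, no Weil type, no Hodge–Weil classes) when `p ≡ 1 (4)`.  So the route's
     anchors exist only on the `p ≡ 3 (4)` half of the imaginary-quadratic fields `ℚ(√-p)`; the other half
     of Weil's family (and all composite `-d`) is outside this line by construction, not by oversight.
   * `p.Prime` — not load-bearing for truth (composite `d ≡ 3 (4)`: same open sector for `ℚ(√-d)`);
     mechanism: the Frobenius group `ℤ/p ⋊ μ` and the two-orbit Hecke algebra `ℚ × ℚ(√-p)` need `p` prime.
   * `A.dim = 2n`, `φ ≫ φ = -p`, the eigenspace membership — not load-bearing for truth (each weakening is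
     again a special case of HC: rational `(n,n)` classes on a smooth projective variety), only for the
     mechanism (Hecke–Prym anchors live in dimension `(p-1)(g-1)` with `K = ℚ(√-p)`).
6. NATURAL STRENGTHENINGS (§5): (a) "+ only"/"− only" typing — TRUE vacuously (item 5, Lean);
   (b) `2 ≤ g` dropped — equivalent (Lean `rung_g_le_one_trivial`); (c) the full sector `∀ n ≥ 1` instead
   of rungs — equivalent modulo `WeilDescending` (item 2, Lean); (d) `W_K ⊆ Dⁿ` (Weil classes are
   polynomials in divisors) — FALSE for the general member (Weil 1977 = vanGeemen1994HodgeAV Thm. 4.11,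
   barrier `Weil1977_exceptionalHodgeClasses`; this is why the classes are exceptional, not evidence of
   non-algebraicity); (e) Kähler version (Weil-type complex TORI) — FALSE (Zucker 1977, Voisin 2002:
   barriers `KaehlerCounterexamples`, `KaehlerCoherentSheaves` — `VoisinWeilTorusWitness`): the general
   Weil-type torus has a Hodge–Weil class and no positive-dimensional proper analytic subvariety; EXCLUDED
   here because `AbelianVariety` is a proper group SCHEME (projective, Mumford §6) — and Markman's proof
   for fourfolds/split sixfolds deforms sheaves THROUGH exactly those tori; (f) integral coefficients —
   not typed by the crux (rational classes only); (g) `p = 3` admitted — a different statement (item 5).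
   None of (a)–(g) is a Lean-refutable strengthening of the crux as typed (item 4).
7. KNOWN COUNTEREXAMPLE FAMILIES OF THE AREA, checked against the binders: Zucker/Voisin Weil tori (not
   schemes — excluded); Atiyah–Hirzebruch/Kollár/Totaro integral classes (rational here — excluded);
   Grothendieck 1969 "trivial reasons" (generalized HC, coniveau ≥ 1 — the crux is ordinary HC in middle
   degree — not applicable); Mumford 1968 / Weil 1977 exceptional classes (these ARE the crux's classes:
   exceptional ≠ non-algebraic; André: motivated).  `ledger negatives --problem HodgeConjecture`
   (2026-08-16): 2 refuted items (Fermat multiset exhaustion; a 22×22 lattice connectivity) — unrelated.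
8. STATUS IN PRINT (from the sibling files' reads of 2026-08-16; remote `lit search` was rc 75 during this
   cycle — re-run on re-arm): for `p ≥ 7` nothing beyond abelian FOURFOLDS (all `K`, all discriminants:
   Markman 2025 + Koike/Schoen descent) and SIXFOLDS of discriminant `-1` (split type, all `K`,
   Markman arXiv:2502.03415 / arXiv:2509.23079) is known; arXiv:2603.20268 §1: "outside this locus the Hodge
   conjecture for Weil classes on sixfolds remains completely open"; no non-algebraicity mechanism exists in
   print (André 1996: a counterexample refutes standard conjecture B for abelian varieties).
9. MECHANISM-LEVEL (not statement-level) negative finding inherited from the sibling seat 1260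
   (`HeckePrymDiscriminant.md`, job in that item's evidence): every Hecke–Prym anchor computed —
   `P(7,2)` (81/81 covers), `P(7,3)` (3/3), `P(11,2)` (2/2) — is of SPLIT Weil type; for rung `(7,2)` that is
   Markman's settled component (route kill criterion K3 at `p = 7`, `g = 2`); in dimension `≥ 8` split type
   is as open as any other, so the ladder's open content is untouched.
10. TARGETS: none (`payload.targets = []`; no line picked for this crux).  §6 is reserved.

## HANDOFF for the next cycle
Landed/landing under `Theorems/HodgeWeilLadder/Negative/`: `SectorEquivalence.lean` (§2–§3 + `2 ≤ g`
decoration), `TypingVacuity.lean` (§4 reality / `p = 3` collapse), `HeckeSign.lean` (Gauss-sum sign).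
Nothing is sorried.  Next regimes: (i) once `PrymVariety` / product abelian varieties land, instantiate
`not_hodgeWeilLadder_of_not_hwa` at the first constructible `(A, φ)`; (ii) if a line is picked, attack its
stubs (NS(7,2) is moot by item 9 — insist the lead starts at (7,3) or at a non-split component);
(iii) re-run the literature sweep (Weil classes 2026, "eightfold", "secant", "Schoen non-cyclic").
-/

noncomputable section

set_option linter.dupNamespace false

open CategoryTheory Complex
open Literature.AlgebraicGeometry Literature.AlgebraicGeometry.HodgeTheory
open Literature.AlgebraicGeometry.Motives Literature.AlgebraicTopology.SingularHomology

namespace Summit.HodgeConjecture.HodgeConjecture.Cruxes.HodgeWeilLadder.Disproof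

open Summit.HodgeConjecture.HodgeConjecture.Theses.HeckePrymWeil
open Summit.HodgeConjecture.HodgeConjecture.Theorems.WeilTwelvefoldsSqrtMinus7.Negative

/-! ## §1 Read-back: the rung predicate, the sector, and the route items as instances -/

/-- The rung predicate `HWA(p, n)` — Hodge–Weil classes algebraic on every abelian `2n`-fold `(A, φ)` with
`φ ∘ φ = -p` — typed VERBATIM as in the route items (work-file abbreviation; the landed Negative files
spell it out). -/
def HWA (p n : ℕ) : Prop :=
  ∀ (A : AbelianVariety ℂ) (φ : A ⟶ A), A.dim = (2 * n) → φ ≫ φ = -((p : ℤ) • 𝟙 A) →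
    ∀ c : complexBetti A.X (2 * n), IsRationalClass c → IsOfHodgeType (2 * n) A.X (2 * n) n n c →
      c ∈ Module.End.eigenspace (complexBetti.map (𝟙 A + φ).hom.hom.hom (2 * n)).hom
            ((1 + I * (Real.sqrt (p : ℝ) : ℂ)) ^ (2 * n)) ⊔
          Module.End.eigenspace (complexBetti.map (𝟙 A + φ).hom.hom.hom (2 * n)).hom
            ((1 - I * (Real.sqrt (p : ℝ) : ℂ)) ^ (2 * n)) →
      c ∈ algebraicClasses A.X n

/-- The whole ℚ(√-p) Hodge–Weil sector, `p ≡ 3 (4)` prime `≥ 7`, all dimensions `2n ≥ 2` (the antecedent of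
`SummitOffWeilSector`; work-file abbreviation). -/
def Sector : Prop :=
  ∀ p : ℕ, p.Prime → p % 4 = 3 → 7 ≤ p → ∀ n : ℕ, 1 ≤ n → HWA p n

/-- READ-BACK of the crux: the ladder is `HWA p ((p-1)/2·(g-1))` for all admissible `p` and all `g ≥ 2`.
Definitional. -/
theorem hodgeWeilLadder_iff :
    HodgeWeilLadder ↔ ∀ p : ℕ, p.Prime → p % 4 = 3 → 7 ≤ p → ∀ g : ℕ, 2 ≤ g →
      ∀ n : ℕ, n = (p - 1) / 2 * (g - 1) → HWA p n :=
  Iff.rfl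

/-- `WeilDescending` is `HWA p (n+1) → HWA p n` (`n ≥ 1`). Definitional. -/
theorem weilDescending_iff :
    WeilDescending ↔ ∀ p : ℕ, p.Prime → p % 4 = 3 → 7 ≤ p → ∀ n : ℕ, 1 ≤ n →
      (∀ m : ℕ, m = n + 1 → HWA p m) → HWA p n :=
  Iff.rfl

/-- `SummitOffWeilSector` is `Sector → HodgeConjecture`. Definitional. -/
theorem summitOffWeilSector_iff : SummitOffWeilSector ↔ (Sector → _root_.HodgeConjecture) :=
  Iff.rfl

/-- The sixfold crux (1260) is the rung `HWA 7 3` (casts normalised by `push_cast`). -/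
theorem weilSixfolds_iff : WeilSixfoldsSqrtMinus7 ↔ HWA 7 3 := by
  unfold HWA WeilSixfoldsSqrtMinus7; push_cast; exact Iff.rfl

/-- The twelvefold crux (1261) is the rung `HWA 7 6`. -/
theorem weilTwelvefolds_iff : WeilTwelvefoldsSqrtMinus7 ↔ HWA 7 6 := by
  unfold HWA WeilTwelvefoldsSqrtMinus7; push_cast; exact Iff.rfl

/-- The tenfold crux (1262) is the rung `HWA 11 5`. -/
theorem weilTenfolds_iff : WeilTenfoldsSqrtMinus11 ↔ HWA 11 5 := by
  unfold HWA WeilTenfoldsSqrtMinus11; push_cast; exact Iff.rfl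

/-! ## §2 Rung-set arithmetic: which dimensions the target names -/

/-- The rungs of the ladder at `p` are exactly the positive multiples of `m = (p-1)/2`. -/
theorem isRung_iff (p n : ℕ) (hp : 7 ≤ p) :
    (∃ g : ℕ, 2 ≤ g ∧ n = (p - 1) / 2 * (g - 1)) ↔ ((p - 1) / 2 ∣ n ∧ 0 < n) := by
  constructor
  · rintro ⟨g, hg, rfl⟩
    refine ⟨Dvd.intro _ rfl, ?_⟩
    have hm : 0 < (p - 1) / 2 := by omega
    exact Nat.mul_pos hm (by omega)
  · rintro ⟨⟨k, rfl⟩, hpos⟩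
    have hk : k ≠ 0 := by rintro rfl; simp at hpos
    exact ⟨k + 1, by omega, by simp⟩

/-- Every rung index is at least `m = (p-1)/2`. -/
theorem rung_ge {p g n : ℕ} (hg : 2 ≤ g) (hn : n = (p - 1) / 2 * (g - 1)) :
    (p - 1) / 2 ≤ n := by
  subst hn
  calc (p - 1) / 2 = (p - 1) / 2 * 1 := (Nat.mul_one _).symm
    _ ≤ (p - 1) / 2 * (g - 1) := Nat.mul_le_mul_left _ (by omega)

/-- … hence at least `3` for `p ≥ 7`: rung dimensions are `≥ 6`. -/
theorem three_le_rung {p g n : ℕ} (hp : 7 ≤ p) (hg : 2 ≤ g) (hn : n = (p - 1) / 2 * (g - 1)) :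
    3 ≤ n := by
  have := rung_ge hg hn
  omega

/-- Rungs at `p = 7`: `n ∈ 3ℕ_{>0}` (dimensions `6, 12, 18, …`). -/
theorem seven_rungs (n : ℕ) : (∃ g : ℕ, 2 ≤ g ∧ n = (7 - 1) / 2 * (g - 1)) ↔ (3 ∣ n ∧ 0 < n) :=
  isRung_iff 7 n le_rfl

/-- Rungs at `p = 11`: `n ∈ 5ℕ_{>0}` (dimensions `10, 20, 30, …`). -/
theorem eleven_rungs (n : ℕ) : (∃ g : ℕ, 2 ≤ g ∧ n = (11 - 1) / 2 * (g - 1)) ↔ (5 ∣ n ∧ 0 < n) :=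
  isRung_iff 11 n (by norm_num)

/-- NOT rungs at `p = 7`: `n = 1, 2, 4, 5` — ℚ(√-7) Weil surfaces, fourfolds, eightfolds and tenfolds are
never named by the target; they are reached only through `WeilDescending`. -/
theorem seven_nonrungs :
    ∀ n ∈ ({1, 2, 4, 5} : Finset ℕ), ¬ ∃ g : ℕ, 2 ≤ g ∧ n = (7 - 1) / 2 * (g - 1) := by
  intro n hn h
  rw [seven_rungs] at h
  simp only [Finset.mem_insert, Finset.mem_singleton] at hn
  rcases hn with rfl | rfl | rfl | rfl <;> omega

/-! ## §3 Sector-equivalence modulo `WeilDescending`; summit-hardness; kill propagation -/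

/-- Generic ladder descent (the induction inside the route's deciding theorem `closes`, isolated): rungs at
the multiples of `M ≥ 1` plus one-step descending give every `n ≥ 1`. -/
theorem ladder_descent (P : ℕ → Prop) (M : ℕ) (hM : 1 ≤ M)
    (hLad : ∀ g : ℕ, 2 ≤ g → ∀ n : ℕ, n = M * (g - 1) → P n)
    (hDesc : ∀ n : ℕ, 1 ≤ n → (∀ m : ℕ, m = n + 1 → P m) → P n) :
    ∀ n : ℕ, 1 ≤ n → P n := by
  intro n hn
  have key : ∀ d k : ℕ, 1 ≤ k → k + d = M * n → P k := by
    intro d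
    induction d with
    | zero =>
      intro k hk hkd
      refine hLad (n + 1) (by omega) k ?_
      rw [Nat.add_sub_cancel]; omega
    | succ d ih =>
      intro k hk hkd
      exact hDesc k hk fun m hm => ih m (by omega) (by omega)
  have hMn : n ≤ M * n := by
    calc n = 1 * n := (Nat.one_mul n).symm
      _ ≤ M * n := Nat.mul_le_mul_right n hM
  exact key (M * n - n) n hn (by omega)

/-- **Rungs are sector instances**: a refutation of the target refutes the whole sector (no descending
needed; rung indices are `≥ 3 ≥ 1`). -/
theorem not_sector_of_not_hodgeWeilLadder (h : ¬ HodgeWeilLadder) : ¬ Sector := by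
  intro hS
  apply h
  intro p hp hp4 hp7 g hg n hn
  exact hS p hp hp4 hp7 n (by have := three_le_rung hp7 hg hn; omega)

/-- **Given `WeilDescending`, a kill of the sector anywhere — any admissible `p`, ANY dimension `2n ≥ 2`
(rung or not), any discriminant — kills the target.** -/
theorem not_hodgeWeilLadder_of_not_sector (hD : WeilDescending) (h : ¬ Sector) : ¬ HodgeWeilLadder := by
  intro hL
  apply h
  intro p hp hp4 hp7
  exact ladder_descent (HWA p) ((p - 1) / 2) (by omega) (hL p hp hp4 hp7) (hD p hp hp4 hp7)

/-- **Equi-refutability**: modulo the routine support item `WeilDescending`, the target is refuted iff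
the entire ℚ(√-p) Hodge–Weil sector is. -/
theorem not_hodgeWeilLadder_iff_not_sector (hD : WeilDescending) : ¬ HodgeWeilLadder ↔ ¬ Sector :=
  ⟨not_sector_of_not_hodgeWeilLadder, not_hodgeWeilLadder_of_not_sector hD⟩

/-- **Kill propagation from one dimension**: given `WeilDescending`, a non-algebraic Hodge–Weil class on
one abelian `2n`-fold with `φ ∘ φ = -p`, `n ≥ 1` arbitrary, refutes the target. -/
theorem not_hodgeWeilLadder_of_not_hwa (hD : WeilDescending) {p : ℕ} (hp : p.Prime) (hp4 : p % 4 = 3)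
    (hp7 : 7 ≤ p) {n : ℕ} (hn : 1 ≤ n) (h : ¬ HWA p n) : ¬ HodgeWeilLadder :=
  not_hodgeWeilLadder_of_not_sector hD fun hS => h (hS p hp hp4 hp7 n hn)

/-- **Kill propagation from a rung** (no descending needed). -/
theorem not_hodgeWeilLadder_of_not_rung {p : ℕ} (hp : p.Prime) (hp4 : p % 4 = 3) (hp7 : 7 ≤ p)
    {g : ℕ} (hg : 2 ≤ g) (h : ¬ HWA p ((p - 1) / 2 * (g - 1))) : ¬ HodgeWeilLadder :=
  fun hL => h (hL p hp hp4 hp7 g hg _ rfl)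

/-- The three rung cruxes, recovered: each kill kills the target (already landed by the sibling seats as
`not_hodgeWeilLadder_of_not_weilSixfoldsSqrtMinus7`, `not_ladder_of_not_weilTwelvefolds`,
`WeilTenfoldsSqrtMinus11.Negative.not_hodgeWeilLadder_of_not`; here via `HWA`). -/
theorem not_hodgeWeilLadder_of_not_rung_cruxes
    (h : ¬ WeilSixfoldsSqrtMinus7 ∨ ¬ WeilTwelvefoldsSqrtMinus7 ∨ ¬ WeilTenfoldsSqrtMinus11) :
    ¬ HodgeWeilLadder := by
  rcases h with h | h | h
  · exact not_hodgeWeilLadder_of_not_rung (p := 7) (by norm_num) (by norm_num) le_rfl (g := 2) le_rfl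
      (by rwa [weilSixfolds_iff] at h)
  · exact not_hodgeWeilLadder_of_not_rung (p := 7) (by norm_num) (by norm_num) le_rfl (g := 3) (by norm_num)
      (by rwa [weilTwelvefolds_iff] at h)
  · exact not_hodgeWeilLadder_of_not_rung (p := 11) (by norm_num) (by norm_num) (by norm_num) (g := 2)
      le_rfl (by rwa [weilTenfolds_iff] at h)

/-- **SUMMIT-HARDNESS**: a refutation of the target is a disproof of the Hodge conjecture
(`HodgeConjecture → Sector` is `antecedent_of_hodgeConjecture`, abelian varieties being smooth projective). -/
theorem not_hodgeConjecture_of_not_hodgeWeilLadder (h : ¬ HodgeWeilLadder) : ¬ _root_.HodgeConjecture :=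
  fun hHC => not_sector_of_not_hodgeWeilLadder h
    (Theorems.SummitOffWeilSector.Negative.antecedent_of_hodgeConjecture hHC)

/-- … and conversely, with the route's other two hypotheses in hand a disproof of HC anywhere would kill
the target (contrapositive of the deciding theorem `closes`). -/
theorem not_hodgeWeilLadder_of_not_hodgeConjecture_of_offSector (hS : SummitOffWeilSector)
    (hD : WeilDescending) (h : ¬ _root_.HodgeConjecture) : ¬ HodgeWeilLadder :=
  -- buildfix 2026-08-19: `closes` now takes all eight route hypotheses; the three used here reach the
  -- summit through this file's own `not_hodgeWeilLadder_of_not_sector` + `summitOffWeilSector_iff`.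
  not_hodgeWeilLadder_of_not_sector hD fun hSec => h (summitOffWeilSector_iff.mp hS hSec)

/-! ## §4 Load-bearing analysis -/

/-! ### `2 ≤ g` is decoration -/

/-- **`2 ≤ g` is pure decoration**: the excluded rungs `g ≤ 1` have `n = 0`, and in codimension `0` every
class is algebraic (`algebraicClasses_zero : algebraicClasses X 0 = ⊤`). So the variant of the crux
WITHOUT `2 ≤ g` is equivalent to the crux. -/
theorem rung_g_le_one_trivial (p g n : ℕ) (hg : g ≤ 1) (hn : n = (p - 1) / 2 * (g - 1)) : HWA p n := by
  have hg0 : g - 1 = 0 := by omega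
  have hn0 : n = 0 := by rw [hn, hg0, Nat.mul_zero]
  subst hn0
  intro A φ _ _ c _ _ _
  rw [algebraicClasses_zero]
  trivial

/-- The `2 ≤ g`-free variant follows from the crux (and trivially implies it). -/
theorem withoutTwoLeG_of_hodgeWeilLadder (hL : HodgeWeilLadder) :
    ∀ p : ℕ, p.Prime → p % 4 = 3 → 7 ≤ p → ∀ g n : ℕ, n = (p - 1) / 2 * (g - 1) → HWA p n := by
  intro p hp hp4 hp7 g n hn
  by_cases hg : 2 ≤ g
  · exact hL p hp hp4 hp7 g hg n hn
  · exact rung_g_le_one_trivial p g n (by omega) hn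

/-! ### `IsRationalClass`: the typed plane has a real structure; one-eigenspace variants are vacuous -/

/-- `conj √p = √p`. -/
theorem conj_sqrt_nat (p : ℕ) : starRingEnd ℂ ((Real.sqrt (p : ℝ) : ℝ) : ℂ) = ((Real.sqrt (p : ℝ) : ℝ) : ℂ) :=
  Complex.conj_ofReal _

/-- `conj((1+i√p)^k) = (1-i√p)^k`. -/
theorem conj_one_add_I_sqrt_pow (p k : ℕ) :
    starRingEnd ℂ ((1 + I * ((Real.sqrt (p : ℝ) : ℝ) : ℂ)) ^ k) = (1 - I * ((Real.sqrt (p : ℝ) : ℝ) : ℂ)) ^ k := by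
  rw [map_pow, map_add, map_one, map_mul, Complex.conj_I, conj_sqrt_nat]; ring

/-- `conj((1-i√p)^k) = (1+i√p)^k`. -/
theorem conj_one_sub_I_sqrt_pow (p k : ℕ) :
    starRingEnd ℂ ((1 - I * ((Real.sqrt (p : ℝ) : ℝ) : ℂ)) ^ k) = (1 + I * ((Real.sqrt (p : ℝ) : ℝ) : ℂ)) ^ k := by
  rw [map_pow, map_sub, map_one, map_mul, Complex.conj_I, conj_sqrt_nat]; ring

/-- The `+` typed eigenvalue is not real, every `p ≥ 4`, every exponent `k ≥ 1` (Niven, landed as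
`one_add_I_sqrt_pow_ne`). -/
theorem conj_plus_ne {p k : ℕ} (hp : 4 ≤ p) (hk : 1 ≤ k) :
    starRingEnd ℂ ((1 + I * ((Real.sqrt (p : ℝ) : ℝ) : ℂ)) ^ k) ≠ (1 + I * ((Real.sqrt (p : ℝ) : ℝ) : ℂ)) ^ k := by
  rw [conj_one_add_I_sqrt_pow]; exact (one_add_I_sqrt_pow_ne p hp k hk).symm

/-- Mirror. -/
theorem conj_minus_ne {p k : ℕ} (hp : 4 ≤ p) (hk : 1 ≤ k) :
    starRingEnd ℂ ((1 - I * ((Real.sqrt (p : ℝ) : ℝ) : ℂ)) ^ k) ≠ (1 - I * ((Real.sqrt (p : ℝ) : ℝ) : ℂ)) ^ k := by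
  rw [conj_one_sub_I_sqrt_pow]; exact one_add_I_sqrt_pow_ne p hp k hk

/-- **A rational class in the `+` typed eigenspace ALONE is zero** — every abelian variety `A`, every
endomorphism `ψ`, every `p ≥ 4`, every degree `k ≥ 1` (conjugation of cochains fixes rational classes and
moves `Eig(ψ^*, μ)` to `Eig(ψ^*, conj μ)`; sibling `eq_zero_of_isRationalClass_of_mem_eigenspace`). -/
theorem rational_mem_plusEigenspace_eq_zero (A : AbelianVariety ℂ) (ψ : A ⟶ A) {p k : ℕ} (hp : 4 ≤ p)
    (hk : 1 ≤ k) {c : complexBetti A.X k} (hr : IsRationalClass c)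
    (hc : c ∈ Module.End.eigenspace (complexBetti.map ψ.hom.hom.hom k).hom
      ((1 + I * ((Real.sqrt (p : ℝ) : ℝ) : ℂ)) ^ k)) : c = 0 :=
  eq_zero_of_isRationalClass_of_mem_eigenspace _ (conj_plus_ne hp hk) hr hc

/-- Mirror: a rational class in the `-` typed eigenspace alone is zero. -/
theorem rational_mem_minusEigenspace_eq_zero (A : AbelianVariety ℂ) (ψ : A ⟶ A) {p k : ℕ} (hp : 4 ≤ p)
    (hk : 1 ≤ k) {c : complexBetti A.X k} (hr : IsRationalClass c)
    (hc : c ∈ Module.End.eigenspace (complexBetti.map ψ.hom.hom.hom k).hom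
      ((1 - I * ((Real.sqrt (p : ℝ) : ℝ) : ℂ)) ^ k)) : c = 0 :=
  eq_zero_of_isRationalClass_of_mem_eigenspace _ (conj_minus_ne hp hk) hr hc

/-- **Refuted-as-vacuous strengthening of the typing, EVERY rung (`+` only)**: the variant of the crux whose
Weil-plane hypothesis keeps only `Eig((𝟙+φ)^*, (1+i√p)^{2n})` holds outright — every admissible class is
`0`. The `⊔` of both eigenspaces is essential to the meaning of every rung. -/
theorem onlyPlusLadder_holds :
    ∀ p : ℕ, p.Prime → p % 4 = 3 → 7 ≤ p → ∀ g : ℕ, 2 ≤ g → ∀ n : ℕ, n = (p - 1) / 2 * (g - 1) →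
      ∀ (A : AbelianVariety ℂ) (φ : A ⟶ A), A.dim = (2 * n) → φ ≫ φ = -((p : ℤ) • 𝟙 A) →
        ∀ c : complexBetti A.X (2 * n), IsRationalClass c → IsOfHodgeType (2 * n) A.X (2 * n) n n c →
          c ∈ Module.End.eigenspace (complexBetti.map (𝟙 A + φ).hom.hom.hom (2 * n)).hom
                ((1 + I * (Real.sqrt (p : ℝ) : ℂ)) ^ (2 * n)) →
          c ∈ algebraicClasses A.X n := by
  intro p _ _ hp g hg n hn A φ _ _ c hr _ hc
  have h3 := three_le_rung hp hg hn
  rw [rational_mem_plusEigenspace_eq_zero A _ (by omega) (by omega) hr hc]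
  exact Submodule.zero_mem _

/-- **Refuted-as-vacuous strengthening of the typing, EVERY rung (`-` only).** -/
theorem onlyMinusLadder_holds :
    ∀ p : ℕ, p.Prime → p % 4 = 3 → 7 ≤ p → ∀ g : ℕ, 2 ≤ g → ∀ n : ℕ, n = (p - 1) / 2 * (g - 1) →
      ∀ (A : AbelianVariety ℂ) (φ : A ⟶ A), A.dim = (2 * n) → φ ≫ φ = -((p : ℤ) • 𝟙 A) →
        ∀ c : complexBetti A.X (2 * n), IsRationalClass c → IsOfHodgeType (2 * n) A.X (2 * n) n n c →
          c ∈ Module.End.eigenspace (complexBetti.map (𝟙 A + φ).hom.hom.hom (2 * n)).hom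
                ((1 - I * (Real.sqrt (p : ℝ) : ℂ)) ^ (2 * n)) →
          c ∈ algebraicClasses A.X n := by
  intro p _ _ hp g hg n hn A φ _ _ c hr _ hc
  have h3 := three_le_rung hp hg hn
  rw [rational_mem_minusEigenspace_eq_zero A _ (by omega) (by omega) hr hc]
  exact Submodule.zero_mem _


/-! ### Shape of any counterexample class: two conjugate, non-zero, non-rational components -/

section Components

variable (A : AbelianVariety ℂ) (ψ : A ⟶ A)

/-- **The Weil components of a rational class are conjugate** — every `p ≥ 4`, every degree `k ≥ 1`: if
`c = c₊ + c₋` is rational with `c± ∈ Eig(ψ^*, (1 ± i√p)^k)` then `conj c₊ = c₋`. [cite: VoisinHodgeI2002, Cor. 6.12] -/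
theorem weilComponents_conj {p k : ℕ} (hp : 4 ≤ p) (hk : 1 ≤ k) {c cp cm : complexBetti A.X k}
    (hr : IsRationalClass c)
    (hcp : cp ∈ Module.End.eigenspace (complexBetti.map ψ.hom.hom.hom k).hom
      ((1 + I * ((Real.sqrt (p : ℝ) : ℝ) : ℂ)) ^ k))
    (hcm : cm ∈ Module.End.eigenspace (complexBetti.map ψ.hom.hom.hom k).hom
      ((1 - I * ((Real.sqrt (p : ℝ) : ℝ) : ℂ)) ^ k))
    (hc : c = cp + cm) : conjClass _ k cp = cm := by
  have hp' := conjClass_mem_eigenspace_map _ hcp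
  have hm' := conjClass_mem_eigenspace_map _ hcm
  rw [conj_one_add_I_sqrt_pow] at hp'
  rw [conj_one_sub_I_sqrt_pow] at hm'
  have hcc : conjClass _ k cp + conjClass _ k cm = cp + cm := by
    rw [← conjClass_add, ← hc, hr.conjClass_eq]
  have hd1 : conjClass _ k cp - cm ∈ Module.End.eigenspace (complexBetti.map ψ.hom.hom.hom k).hom
      ((1 - I * ((Real.sqrt (p : ℝ) : ℝ) : ℂ)) ^ k) := Submodule.sub_mem _ hp' hcm
  have heq : conjClass _ k cp - cm = cp - conjClass _ k cm := by
    rw [sub_eq_sub_iff_add_eq_add, hcc]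
  have hd2 : conjClass _ k cp - cm ∈ Module.End.eigenspace (complexBetti.map ψ.hom.hom.hom k).hom
      ((1 + I * ((Real.sqrt (p : ℝ) : ℝ) : ℂ)) ^ k) := by
    rw [heq]; exact Submodule.sub_mem _ hcp hm'
  exact sub_eq_zero.1 (eq_zero_of_mem_eigenspace_of_mem_eigenspace _
    (one_add_I_sqrt_pow_ne p hp k hk) hd2 hd1)

/-- **Refuted strengthening: rational components.** If the `+` component of a rational class of the typed
plane is itself rational, the class is `0` — the crux can never be applied to a component separately.
[folklore] -/
theorem weilComponent_rational_imp_zero {p k : ℕ} (hp : 4 ≤ p) (hk : 1 ≤ k) {c cp cm : complexBetti A.X k}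
    (hr : IsRationalClass c)
    (hcp : cp ∈ Module.End.eigenspace (complexBetti.map ψ.hom.hom.hom k).hom
      ((1 + I * ((Real.sqrt (p : ℝ) : ℝ) : ℂ)) ^ k))
    (hcm : cm ∈ Module.End.eigenspace (complexBetti.map ψ.hom.hom.hom k).hom
      ((1 - I * ((Real.sqrt (p : ℝ) : ℝ) : ℂ)) ^ k))
    (hc : c = cp + cm) (hpr : IsRationalClass cp) : c = 0 := by
  have h0 : cp = 0 := rational_mem_plusEigenspace_eq_zero A ψ hp hk hpr hcp
  have h1 := weilComponents_conj A ψ hp hk hr hcp hcm hc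
  rw [h0, conjClass_zero] at h1
  rw [hc, h0, ← h1, add_zero]

/-- **A non-zero rational class of the typed plane has BOTH components non-zero** (so a counterexample
class to any rung has two non-zero, conjugate, non-rational Weil components). [folklore] -/
theorem weilComponents_ne_zero {p k : ℕ} (hp : 4 ≤ p) (hk : 1 ≤ k) {c cp cm : complexBetti A.X k}
    (hr : IsRationalClass c)
    (hcp : cp ∈ Module.End.eigenspace (complexBetti.map ψ.hom.hom.hom k).hom
      ((1 + I * ((Real.sqrt (p : ℝ) : ℝ) : ℂ)) ^ k))
    (hcm : cm ∈ Module.End.eigenspace (complexBetti.map ψ.hom.hom.hom k).hom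
      ((1 - I * ((Real.sqrt (p : ℝ) : ℝ) : ℂ)) ^ k))
    (hc : c = cp + cm) (h0 : c ≠ 0) : cp ≠ 0 ∧ cm ≠ 0 := by
  have h1 := weilComponents_conj A ψ hp hk hr hcp hcm hc
  constructor
  · intro hz
    apply h0
    exact weilComponent_rational_imp_zero A ψ hp hk hr hcp hcm hc (by rw [hz]; exact IsRationalClass.zero)
  · intro hz
    apply h0
    have : cp = 0 := by
      have h2 := congrArg (conjClass _ k) h1
      rw [conjClass_conjClass, hz, conjClass_zero] at h2
      exact h2
    exact weilComponent_rational_imp_zero A ψ hp hk hr hcp hcm hc (by rw [this]; exact IsRationalClass.zero)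

end Components

/-! ### `7 ≤ p`: at `p = 3` the typing collapses (it is NOT the Weil plane there) -/

/-- **At `p = 3` the two typed eigenvalues of the sixfold rung COINCIDE**: `(1+i√3)^6 = (1-i√3)^6`
(both cubes are `-8`, landed `one_add_I_sqrt3_cube`, `one_sub_I_sqrt3_cube`). -/
theorem typing_collapses_at_three :
    (1 + I * ((Real.sqrt (3 : ℝ) : ℝ) : ℂ)) ^ (2 * 3) = (1 - I * ((Real.sqrt (3 : ℝ) : ℝ) : ℂ)) ^ (2 * 3) := by
  have h1 : (1 + I * ((Real.sqrt (3 : ℝ) : ℝ) : ℂ)) ^ (2 * 3) =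
      ((1 + I * ((Real.sqrt (3 : ℝ) : ℝ) : ℂ)) ^ 3) ^ 2 := by ring
  have h2 : (1 - I * ((Real.sqrt (3 : ℝ) : ℝ) : ℂ)) ^ (2 * 3) =
      ((1 - I * ((Real.sqrt (3 : ℝ) : ℝ) : ℂ)) ^ 3) ^ 2 := by ring
  rw [h1, h2, one_add_I_sqrt3_cube, one_sub_I_sqrt3_cube]

/-- … their common value is `64` … -/
theorem typed_eigenvalues_at_three : (1 + I * ((Real.sqrt (3 : ℝ) : ℝ) : ℂ)) ^ (2 * 3) = 64 ∧
    (1 - I * ((Real.sqrt (3 : ℝ) : ℝ) : ℂ)) ^ (2 * 3) = 64 := by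
  have h1 : (1 + I * ((Real.sqrt (3 : ℝ) : ℝ) : ℂ)) ^ (2 * 3) =
      ((1 + I * ((Real.sqrt (3 : ℝ) : ℝ) : ℂ)) ^ 3) ^ 2 := by ring
  have h2 : (1 - I * ((Real.sqrt (3 : ℝ) : ℝ) : ℂ)) ^ (2 * 3) =
      ((1 - I * ((Real.sqrt (3 : ℝ) : ℝ) : ℂ)) ^ 3) ^ 2 := by ring
  rw [h1, h2, one_add_I_sqrt3_cube, one_sub_I_sqrt3_cube]; norm_num

/-- … and the MIDDLE Künneth type `(a, b) = (3, 3)` — the summand `∧³H¹_σ ⊗ ∧³H¹_σ̄`, home of the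
divisor-power classes `D³` — has the same eigenvalue `(1+i√3)^3 (1-i√3)^3 = 64`: at `p = 3` the typed
"Weil plane" `Eig ⊔ Eig = Eig(64)` is NOT the Weil plane. This is what `7 ≤ p` (really `p ≠ 3`) buys. -/
theorem middle_type_collides_at_three :
    (1 + I * ((Real.sqrt (3 : ℝ) : ℝ) : ℂ)) ^ 3 * (1 - I * ((Real.sqrt (3 : ℝ) : ℝ) : ℂ)) ^ 3 = 64 := by
  rw [one_add_I_sqrt3_cube, one_sub_I_sqrt3_cube]; norm_num

/-- Contrast: for every `p ≥ 4` the two typed eigenvalues of EVERY rung differ (landed, Niven). -/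
theorem typing_faithful_from_four {p : ℕ} (hp : 4 ≤ p) {n : ℕ} (hn : 1 ≤ n) :
    (1 + I * ((Real.sqrt (p : ℝ) : ℝ) : ℂ)) ^ (2 * n) ≠ (1 - I * ((Real.sqrt (p : ℝ) : ℝ) : ℂ)) ^ (2 * n) :=
  one_add_I_sqrt_pow_ne p hp (2 * n) (by omega)

/-! ### `p % 4 = 3`: the sign of the quadratic Gauss sum (mechanism, not truth) -/

section HeckeSign

open ZMod MulChar

/-- **Why `p % 4 = 3`**: the Hecke element `φ = T_squares - T_nonsquares = Σ_k (k/p)·[k]` of `ℤ/p ⋊ μ` acts on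
the `ψ`-isotypic part of a `ℤ/p`-representation by the quadratic Gauss sum `g = Σ_k (k/p) ψ(k)`, and
`g² = χ(-1)·p = χ₄(p)·p` (Mathlib `gaussSum_sq`). -/
theorem quadGaussSum_sq (p : ℕ) [hp : Fact p.Prime] (hp2 : p ≠ 2) :
    gaussSum ((quadraticChar (ZMod p)).ringHomComp (Int.castRingHom ℂ)) (ZMod.stdAddChar (N := p)) ^ 2
      = (ZMod.χ₄ p : ℂ) * p := by
  have hF : ringChar (ZMod p) ≠ 2 := by rwa [ZMod.ringChar_zmod_n]
  have h1 : (quadraticChar (ZMod p)).ringHomComp (Int.castRingHom ℂ) ≠ 1 :=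
    (MulChar.ringHomComp_ne_one_iff Int.cast_injective).2 (quadraticChar_ne_one hF)
  have h2 : ((quadraticChar (ZMod p)).ringHomComp (Int.castRingHom ℂ)).IsQuadratic :=
    (quadraticChar_isQuadratic (ZMod p)).comp _
  haveI : NeZero p := ⟨hp.out.ne_zero⟩
  have h3 := ZMod.isPrimitive_stdAddChar p
  rw [gaussSum_sq h1 h2 h3, ZMod.card p, MulChar.ringHomComp_apply, quadraticChar_neg_one hF, ZMod.card p]
  simp

/-- `p ≡ 3 (4)`: `g² = -p` — the Hecke correspondence is a multiplication by `√-p` (Weil type possible). -/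
theorem quadGaussSum_sq_of_three_mod_four (p : ℕ) [Fact p.Prime] (hp3 : p % 4 = 3) :
    gaussSum ((quadraticChar (ZMod p)).ringHomComp (Int.castRingHom ℂ)) (ZMod.stdAddChar (N := p)) ^ 2
      = -(p : ℂ) := by
  rw [quadGaussSum_sq p (by omega), ZMod.χ₄_nat_three_mod_four hp3]; simp

/-- `p ≡ 1 (4)`: `g² = +p` — the same Hecke correspondence is REAL multiplication by `ℚ(√p)`: no Weil type,
no Hodge–Weil classes, no anchor. The `p ≡ 1 (4)` half of Weil's family is outside this line by construction. -/
theorem quadGaussSum_sq_of_one_mod_four (p : ℕ) [Fact p.Prime] (hp1 : p % 4 = 1) :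
    gaussSum ((quadraticChar (ZMod p)).ringHomComp (Int.castRingHom ℂ)) (ZMod.stdAddChar (N := p)) ^ 2
      = (p : ℂ) := by
  rw [quadGaussSum_sq p (by omega), ZMod.χ₄_nat_one_mod_four hp1]; simp

end HeckeSign

/-! ### `IsOfHodgeType`, `A.dim = 2n`, `φ ≫ φ = -p`, `p.Prime` (paper; see the module docstring item 5)

No Lean shape beyond the circular `witness → ¬ weakened crux` is available while no abelian variety of
positive dimension is constructible (item 4); the sibling file `Cruxes/WeilSixfoldsSqrtMinus7/Disproof.lean`
§4 records that shape for the sixfold rung and it transfers verbatim to every rung. -/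

/-! ## §5 Natural strengthenings — see the module docstring item 6 (Lean content: `onlyPlusLadder_holds`,
`onlyMinusLadder_holds`, `rung_g_le_one_trivial`, `not_hodgeWeilLadder_iff_not_sector`). -/

/-! ## §6 Targets — none this cycle (`payload.targets = []`). -/

end Summit.HodgeConjecture.HodgeConjecture.Cruxes.HodgeWeilLadder.Disproof

end
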